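import Summits.CriticalPhenomena.PercolationContinuityZ3.Theorems.Transplant.SkelNegBParamsRootLam
import Summits.CriticalPhenomena.PercolationContinuityZ3.Theorems.Transplant.SkelNegBParamsRootArith
import Summits.CriticalPhenomena.PercolationContinuityZ3.Theorems.Transplant.SkelNegBChoiceAllT
import Summits.CriticalPhenomena.PercolationContinuityZ3.Theorems.Transplant.SkelPhiParaRunChain
import HarnessLib

/-!
# N1 params, chain of record `NegB`, part RootVals: THE x-RUN OF THE ROOT RESIDUE AT THE LEDGER — its prism / last-core boxes (`hprism`, `hlastc`), the stride
# count `NegB.KS.NrOf σ yL` (centred on the target `20r₀` from the run origin's fine abscissa), and the (c)-block of p3's `rootOblTWAt_of_numbers6_x` DISCHARGED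
# for ANY run origin `yL` with `|Λ₀(yL)| ≤ 3m`, `|Λ₁(yL)| ≤ 2m` and any `qB` with `4qB ≤ n_L` (parts RootArith/RootArithP do the arithmetic, part RootFine the (c)-block wrappers; here the ledger's
# literals `20K·s₀ = 800·(Kq s₀)`, `Dof = 640000·m`, `lam0 800 v_L v_β yL = 800·Λ₀(yL)`, `r₀ = 40·Kq s₀`, `b0T₀ = 10·Kq s₀` are substituted)

builds on p205010 (kernel theorem, internal audit signed; external expert review pending) — nothing in this file uses p205010; NOTHING is claimed about
the node `SamePDropOfSkeletonNeg₁` (OPEN).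
Lane `prim-bschramm-*`, seat `prim-bschramm-stmt` (gen 14); helper file (`--supports stmt-CriticalPhenomena-4575 --as helper`); ledger HOME/prim-bschramm-stmt/NEG-PARAMS.md v0.13.
* §1 `KS.Wrun/Lbrun/paLo/paHi/pbHi/laLo/laHi/lbHi` (+ **`hprism_R`**, **`hlastc_R`**, `Wrun_spec`, `Lbrun_spec`);
* §2 `KS.Λ₀of/Λ₁of/u₀/u₁/Fc/NrOf`, `c₀_eq/c₁_eq/Dof_eq'/lam0_eq/lam1_eq/r_eq/b0T_eq'`, **`NrOf_spec`** (`1 + Nr ≤ 1000`, the centring);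
* (part RootFine: `hLg₁_R/hLg₂_R/hLg₃_R`, `hPf₁_R/hPf₂_R/hPf₃_R`).
[cite: KozmaNitzan2024, §4 p. 28 ((32) at the root), Lemma 11 (p. 22)] [cite: MartineauTassion2017, §4.3 Lemma 4.2]
-/

noncomputable section

open scoped Classical

namespace Summit.CriticalPhenomena.PercolationContinuityZ3.Theorems.Transplant

namespace PlanarSkeletonNeg

namespace NegB

open Literature.Probability.Percolation Literature.Probability.LatticeModels SimpleGraph
open Literature.Probability.Percolation.KozmaNitzan.Cells (oth)
open SkelConc (Consts)
open Skelφ (shearUnit shearUnit_pos xRunSched xPrmW)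
open Skelφ.StepI (DataN)
open TwoAxis.Para (modulus)
open Neg

namespace KS

/-! ## §1 The x-run's prism and last core as boxes -/

section Boxes

variable (κ : Consts) {V : Type} [DecidableEq V] [Countable V] {G : SimpleGraph V} [G.LocallyFinite] (Φ : PlanarSkeletonNeg G) (t : V)
  (p : unitInterval) (D : DataN V) (g f mk qB Nr : ℕ)

/-- The window half-width `W := n_Lℓ_L/U + 1` of the x-run (`xPrmW`'s `Wp = Wm`). [this work] -/
def Wrun : ℕ := nL κ Φ t p D g f * ℓL κ Φ t p D g f / shearUnit (nL κ Φ t p D g f) (hL κ Φ t p D g f) + 1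

/-- The link box's transverse half-size `Lb := 3n_Lℓ_L/U + 1`. [this work] -/
def Lbrun : ℕ := 3 * (nL κ Φ t p D g f * ℓL κ Φ t p D g f) / shearUnit (nL κ Φ t p D g f) (hL κ Φ t p D g f) + 1

/-- The prism's lower along-corner `−qB − (Nr+1)RA′ − n_L`. [this work] -/
def paLo : ℤ := -(qB : ℤ) - ((Nr : ℤ) + 1) * RA' κ Φ t p D mk - nL κ Φ t p D g f

/-- The prism's upper along-corner `Nr·n_L + qB + (Nr+1)RA′ + n_L`. [this work] -/
def paHi : ℤ := (Nr : ℤ) * nL κ Φ t p D g f + qB + ((Nr : ℤ) + 1) * RA' κ Φ t p D mk + nL κ Φ t p D g f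

/-- The prism's transverse half-size `W + (Nr+1)RA′ + Lb`. [this work] -/
def pbHi : ℤ := (Wrun κ Φ t p D g f : ℤ) + ((Nr : ℤ) + 1) * RA' κ Φ t p D mk + Lbrun κ Φ t p D g f

/-- The last core's lower along-corner `(Nr+1)n_L − qB − (Nr+1)RA′`. [this work] -/
def laLo : ℤ := ((Nr : ℤ) + 1) * nL κ Φ t p D g f - qB - ((Nr : ℤ) + 1) * RA' κ Φ t p D mk

/-- The last core's upper along-corner `(Nr+1)n_L + qB + (Nr+1)RA′`. [this work] -/
def laHi : ℤ := ((Nr : ℤ) + 1) * nL κ Φ t p D g f + qB + ((Nr : ℤ) + 1) * RA' κ Φ t p D mk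

/-- The last core's transverse half-size `W + (Nr+1)RA′`. [this work] -/
def lbHi : ℤ := (Wrun κ Φ t p D g f : ℤ) + ((Nr : ℤ) + 1) * RA' κ Φ t p D mk

/-- `U·W ≤ n_Lℓ_L + U` and `U·Lb ≤ 3n_Lℓ_L + U` (floor division). [folklore] -/
theorem Wrun_spec (hn : 1 ≤ nL κ Φ t p D g f) :
    (shearUnit (nL κ Φ t p D g f) (hL κ Φ t p D g f) : ℤ) * (Wrun κ Φ t p D g f : ℤ) ≤ (nL κ Φ t p D g f : ℤ) * ℓL κ Φ t p D g f + shearUnit (nL κ Φ t p D g f) (hL κ Φ t p D g f) ∧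
      (shearUnit (nL κ Φ t p D g f) (hL κ Φ t p D g f) : ℤ) * (Lbrun κ Φ t p D g f : ℤ) ≤ 3 * ((nL κ Φ t p D g f : ℤ) * ℓL κ Φ t p D g f) + shearUnit (nL κ Φ t p D g f) (hL κ Φ t p D g f) := by
  have hU : 0 < shearUnit (nL κ Φ t p D g f) (hL κ Φ t p D g f) := by unfold Skelφ.shearUnit; omega
  have h1 := Nat.div_mul_le_self (nL κ Φ t p D g f * ℓL κ Φ t p D g f) (shearUnit (nL κ Φ t p D g f) (hL κ Φ t p D g f))
  have h2 := Nat.div_mul_le_self (3 * (nL κ Φ t p D g f * ℓL κ Φ t p D g f)) (shearUnit (nL κ Φ t p D g f) (hL κ Φ t p D g f))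
  unfold Wrun Lbrun
  constructor
  · push_cast; nlinarith
  · push_cast; nlinarith

/-- **`hprism`**: the x-run's prism is the box `[paLo, paHi] × [−pbHi, pbHi]`. [folklore] -/
theorem hprism_R : (xRunSched (nL κ Φ t p D g f) (ℓL κ Φ t p D g f) (hL κ Φ t p D g f) (RA' κ Φ t p D mk) qB Nr).prism ⊆
    Finset.Icc (Skelφ.pt (paLo κ Φ t p D g f mk qB Nr) (-pbHi κ Φ t p D g f mk Nr)) (Skelφ.pt (paHi κ Φ t p D g f mk qB Nr) (pbHi κ Φ t p D g f mk Nr)) := by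
  intro y hy
  rw [Skelφ.xRunSched, ChainPara.RunPrm.scheduleN_prism, ChainPara.RunPrm.mem_pprism_iff (Or.inl rfl)] at hy
  unfold ChainPara.RunPrm.InPrism at hy
  simp only [one_mul, Skelφ.xPrmW, Pi.zero_apply, sub_zero, abs_zero, mul_zero, neg_zero, zero_sub, zero_add] at hy
  rw [Skelφ.mem_Icc_pt_iff]
  have ho : oth (0 : Fin 2) = 1 := rfl
  rw [ho] at hy
  unfold paLo paHi pbHi Wrun Lbrun
  simp only [Nat.cast_add, Nat.cast_one] at hy ⊢
  obtain ⟨h1, h2, h3, h4⟩ := hy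
  refine ⟨⟨by linarith, by linarith⟩, ⟨by linarith, by linarith⟩⟩

/-- **`hlastc`**: the x-run's core `Nr + 1` is the box `[laLo, laHi] × [−lbHi, lbHi]`. [folklore] -/
theorem hlastc_R : (xRunSched (nL κ Φ t p D g f) (ℓL κ Φ t p D g f) (hL κ Φ t p D g f) (RA' κ Φ t p D mk) qB Nr).core (Nr + 1) ⊆
    Finset.Icc (Skelφ.pt (laLo κ Φ t p D g f mk qB Nr) (-lbHi κ Φ t p D g f mk Nr)) (Skelφ.pt (laHi κ Φ t p D g f mk qB Nr) (lbHi κ Φ t p D g f mk Nr)) := by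
  intro y hy
  rw [Skelφ.xRunSched, Skelφ.mem_scheduleN_core_iff (Skelφ.xPrmW_ok _ _ _ _ _ _) (Skelφ.xPrmW_eb _ _ _ _ _ _)] at hy
  unfold ChainPara.RunPrm.InCore ChainPara.RunPrm.aLo ChainPara.RunPrm.aHi ChainPara.RunPrm.bLo ChainPara.RunPrm.bHi at hy
  simp only [Skelφ.xPrmW, mul_zero, zero_sub, zero_add] at hy
  rw [Skelφ.mem_Icc_pt_iff]
  unfold laLo laHi lbHi Wrun
  simp only [Nat.cast_add, Nat.cast_one] at hy ⊢
  obtain ⟨h1, h2, h3, h4⟩ := hy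
  refine ⟨⟨by linarith, by linarith⟩, ⟨by linarith, by linarith⟩⟩

end Boxes


/-! ## §2 The run origin's functionals, the stride unit, the stride count -/

section Origin

variable (κ : Consts) {V : Type} [DecidableEq V] [Countable V] {G : SimpleGraph V} [G.LocallyFinite] (Φ : PlanarSkeletonNeg G) (t : V)
  (p : unitInterval) (D : DataN V) (g f : ℕ)

/-- The stride unit along axis `0`: `u₀ := Kq·s₀` (`c₀ = 800u₀`, `r₀ = 40u₀`, `b0T₀ = 10u₀`). [this work] -/
def u₀ : ℤ := (Neg.Kq κ : ℤ) * (((fcells κ Φ t p D g f).s 0 : ℕ) : ℤ)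

/-- The stride unit along axis `1`: `u₁ := Kq·s₁`. [this work] -/
def u₁ : ℤ := (Neg.Kq κ : ℤ) * (((fcells κ Φ t p D g f).s 1 : ℕ) : ℤ)

/-- `Λ₀(y) := v_β·y₀ − v_L·y₁` (`lam0 800 v_L v_β y = 800·Λ₀(y)`). [this work] -/
def Λ₀of (y : Site 2) : ℤ := Skelφ.NegPrm.vβOf (nL κ Φ t p D g f) (hL κ Φ t p D g f) (ℓL κ Φ t p D g f) (vL κ Φ t p D g f) * y 0 - vL κ Φ t p D g f * y 1

/-- `Λ₁(y) := n_L·y₁ − h_L·y₀` (`lam1 800 n_L h_L y = 800·Λ₁(y)`). [this work] -/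
def Λ₁of (y : Site 2) : ℤ := (nL κ Φ t p D g f : ℤ) * y 1 - hL κ Φ t p D g f * y 0

/-- **The run origin's fine abscissa** `Fc(y) := coarse c₀ (D/2) D (lam0 800 v_L v_β y)` (p3's literal). [this work] -/
def Fc (y : Site 2) : ℤ :=
  TwoAxis.Para.coarse (20 * ((fcells κ Φ t p D g f).K : ℤ) * (((fcells κ Φ t p D g f).s 0 : ℕ) : ℤ))
    (Skelφ.NegPrm.Dof (nL κ Φ t p D g f) (hL κ Φ t p D g f) (ℓL κ Φ t p D g f) (vL κ Φ t p D g f) / 2)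
    (Skelφ.NegPrm.Dof (nL κ Φ t p D g f) (hL κ Φ t p D g f) (ℓL κ Φ t p D g f) (vL κ Φ t p D g f))
    (TwoAxis.Para.lam0 800 (vL κ Φ t p D g f) (Skelφ.NegPrm.vβOf (nL κ Φ t p D g f) (hL κ Φ t p D g f) (ℓL κ Φ t p D g f) (vL κ Φ t p D g f)) y)

/-- **THE STRIDE COUNT** `Nr := round((800u₀ − σ·Fc)/u₀) − 1` (so that `Fc + σu₀(Nr+1) ≈ σ·800u₀ = σ·20r₀`). [this work] -/
def NrOf (σ : ℤ) (y : Site 2) : ℕ := Int.toNat ((800 * u₀ κ Φ t p D g f - σ * Fc κ Φ t p D g f y + u₀ κ Φ t p D g f / 2) / u₀ κ Φ t p D g f - 1)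

/-- The ledger's literals in stride units: `c₀ = 800u₀`, `c₁ = 800u₁`, `r₀ = 40u₀`, `r₁ = 40u₁`, `b0T₀ = 10u₀`, `b0T₁ = 10u₁`, `1 ≤ u₀`, `1 ≤ u₁`. [folklore] -/
theorem units_eq : 20 * ((fcells κ Φ t p D g f).K : ℤ) * (((fcells κ Φ t p D g f).s 0 : ℕ) : ℤ) = 800 * u₀ κ Φ t p D g f ∧
    20 * ((fcells κ Φ t p D g f).K : ℤ) * (((fcells κ Φ t p D g f).s 1 : ℕ) : ℤ) = 800 * u₁ κ Φ t p D g f ∧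
    ((fcells κ Φ t p D g f).r 0 : ℤ) = 40 * u₀ κ Φ t p D g f ∧ ((fcells κ Φ t p D g f).r 1 : ℤ) = 40 * u₁ κ Φ t p D g f ∧
    (b0T κ Φ t p D g f 0 : ℤ) = 10 * u₀ κ Φ t p D g f ∧ (b0T κ Φ t p D g f 1 : ℤ) = 10 * u₁ κ Φ t p D g f ∧
    1 ≤ u₀ κ Φ t p D g f ∧ 1 ≤ u₁ κ Φ t p D g f := by
  have hK : ((fcells κ Φ t p D g f).K : ℤ) = 40 * (Neg.Kq κ : ℤ) := by rw [(fcells_K κ Φ t p D g f).1, Neg.K_eq]; push_cast; ring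
  have hr := (fcells_K κ Φ t p D g f).2.2
  have hq : (1 : ℤ) ≤ Neg.Kq κ := by exact_mod_cast Neg.one_le_Kq κ
  have hs0 : (1 : ℤ) ≤ (((fcells κ Φ t p D g f).s 0 : ℕ) : ℤ) := by exact_mod_cast (fcells κ Φ t p D g f).hs 0
  have hs1 : (1 : ℤ) ≤ (((fcells κ Φ t p D g f).s 1 : ℕ) : ℤ) := by exact_mod_cast (fcells κ Φ t p D g f).hs 1
  unfold u₀ u₁
  refine ⟨by rw [hK]; ring, by rw [hK]; ring, ?_, ?_, ?_, ?_, by nlinarith, by nlinarith⟩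
  · rw [hr 0, Neg.K_eq]; push_cast; ring
  · rw [hr 1, Neg.K_eq]; push_cast; ring
  · rw [b0T_eq]; push_cast; ring
  · rw [b0T_eq]; push_cast; ring

/-- `Dof = 640000·m`. [folklore] -/
theorem Dof_eq' : Skelφ.NegPrm.Dof (nL κ Φ t p D g f) (hL κ Φ t p D g f) (ℓL κ Φ t p D g f) (vL κ Φ t p D g f) =
    640000 * modulus (nL κ Φ t p D g f) (hL κ Φ t p D g f) (vL κ Φ t p D g f) (Skelφ.NegPrm.vβOf (nL κ Φ t p D g f) (hL κ Φ t p D g f) (ℓL κ Φ t p D g f) (vL κ Φ t p D g f)) := by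
  rw [Dof_eq_sq_mul]; norm_num; rfl

/-- `lam0 800 v_L v_β y = 800·Λ₀(y)`, `lam1 800 n_L h_L y = 800·Λ₁(y)`. [folklore] -/
theorem lam_eq (y : Site 2) :
    TwoAxis.Para.lam0 800 (vL κ Φ t p D g f) (Skelφ.NegPrm.vβOf (nL κ Φ t p D g f) (hL κ Φ t p D g f) (ℓL κ Φ t p D g f) (vL κ Φ t p D g f)) y = 800 * Λ₀of κ Φ t p D g f y ∧
      TwoAxis.Para.lam1 800 (nL κ Φ t p D g f : ℤ) (hL κ Φ t p D g f) y = 800 * Λ₁of κ Φ t p D g f y := ⟨rfl, rfl⟩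

/-- `Fc(y) = (800u₀·(800Λ₀(y)) + 640000m/2)/(640000m)` (the RootArith shape). [folklore] -/
theorem Fc_eq (y : Site 2) : Fc κ Φ t p D g f y =
    (800 * u₀ κ Φ t p D g f * (800 * Λ₀of κ Φ t p D g f y) +
        640000 * modulus (nL κ Φ t p D g f) (hL κ Φ t p D g f) (vL κ Φ t p D g f) (Skelφ.NegPrm.vβOf (nL κ Φ t p D g f) (hL κ Φ t p D g f) (ℓL κ Φ t p D g f) (vL κ Φ t p D g f)) / 2) /
      (640000 * modulus (nL κ Φ t p D g f) (hL κ Φ t p D g f) (vL κ Φ t p D g f) (Skelφ.NegPrm.vβOf (nL κ Φ t p D g f) (hL κ Φ t p D g f) (ℓL κ Φ t p D g f) (vL κ Φ t p D g f))) := by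
  unfold Fc TwoAxis.Para.coarse
  rw [(units_eq κ Φ t p D g f).1, Dof_eq', (lam_eq κ Φ t p D g f y).1]

/-- **The stride count is admissible and centred**: `1 + Nr ≤ 1000` and `|Fc + σ·u₀·(Nr+1) − σ·800u₀| ≤ u₀`, whenever `|Λ₀(y)| ≤ 3m` (`σ = ±1`).
[cite: KozmaNitzan2024, §4 Lemma 11 (p. 22)] -/
theorem NrOf_spec (hN : EqNumL κ Φ t p D g f) {σ : ℤ} (hσ : σ = 1 ∨ σ = -1) (y : Site 2)
    (hΛ : |Λ₀of κ Φ t p D g f y| ≤ 3 * modulus (nL κ Φ t p D g f) (hL κ Φ t p D g f) (vL κ Φ t p D g f) (Skelφ.NegPrm.vβOf (nL κ Φ t p D g f) (hL κ Φ t p D g f) (ℓL κ Φ t p D g f) (vL κ Φ t p D g f))) :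
    0 + 1 + NrOf κ Φ t p D g f σ y ≤ 1000 ∧
      |Fc κ Φ t p D g f y + σ * u₀ κ Φ t p D g f * ((NrOf κ Φ t p D g f σ y : ℤ) + 1) - σ * 800 * u₀ κ Φ t p D g f| ≤ u₀ κ Φ t p D g f := by
  obtain ⟨hn1, hℓ1⟩ := one_le_of_eqNumL κ Φ t p D g f hN
  have hm : 0 < modulus (nL κ Φ t p D g f) (hL κ Φ t p D g f) (vL κ Φ t p D g f) (Skelφ.NegPrm.vβOf (nL κ Φ t p D g f) (hL κ Φ t p D g f) (ℓL κ Φ t p D g f) (vL κ Φ t p D g f)) :=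
    Skelφ.NegPrm.modulus_vβOf_pos hn1 hℓ1 _ _
  have hu := (units_eq κ Φ t p D g f).2.2.2.2.2.2.1
  obtain ⟨f1, f2⟩ := RootArith.coarse_bounds (u := u₀ κ Φ t p D g f) (Λ := Λ₀of κ Φ t p D g f y) hm
  rw [← Fc_eq] at f1 f2
  set F := Fc κ Φ t p D g f y
  set u := u₀ κ Φ t p D g f
  set m := modulus (nL κ Φ t p D g f) (hL κ Φ t p D g f) (vL κ Φ t p D g f) (Skelφ.NegPrm.vβOf (nL κ Φ t p D g f) (hL κ Φ t p D g f) (ℓL κ Φ t p D g f) (vL κ Φ t p D g f))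
  obtain ⟨hΛ1, hΛ2⟩ := abs_le.1 hΛ
  have hFlo : -3 * u ≤ F := by
    by_contra hc; push Not at hc
    have h1 : 2 * m * F ≤ 2 * m * (-3 * u - 1) := mul_le_mul_of_nonneg_left (by linarith) (by positivity)
    nlinarith
  have hFhi : F ≤ 3 * u := by
    by_contra hc; push Not at hc
    have h1 : 2 * m * (3 * u + 1) ≤ 2 * m * F := mul_le_mul_of_nonneg_left (by linarith) (by positivity)
    nlinarith
  obtain ⟨d1, d2⟩ := RootArith.floor_sandwich (x := u) (d := 2) (by norm_num)
  have hu0 : 0 < u := by linarith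
  obtain ⟨x1, x2⟩ := RootArith.floor_sandwich (x := 800 * u - σ * F + u / 2) (d := u) hu0
  set X := (800 * u - σ * F + u / 2) / u
  have hσF : |σ * F| ≤ 3 * u := by
    rcases hσ with rfl | rfl
    · rw [one_mul]; exact abs_le.2 ⟨by linarith, hFhi⟩
    · rw [neg_one_mul, abs_neg]; exact abs_le.2 ⟨by linarith, hFhi⟩
  obtain ⟨s1, s2⟩ := abs_le.1 hσF
  have hXlo : 796 ≤ X := by
    by_contra hc; push Not at hc
    have : u * X ≤ u * 795 := mul_le_mul_of_nonneg_left (by linarith) hu0.le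
    nlinarith
  have hXhi : X ≤ 804 := by
    by_contra hc; push Not at hc
    have : u * 805 ≤ u * X := mul_le_mul_of_nonneg_left (by linarith) hu0.le
    nlinarith
  have hNr : (NrOf κ Φ t p D g f σ y : ℤ) = X - 1 := by
    show (Int.toNat ((800 * u - σ * F + u / 2) / u - 1) : ℤ) = X - 1
    rw [Int.toNat_of_nonneg (by linarith)]
  constructor
  · have : ((0 + 1 + NrOf κ Φ t p D g f σ y : ℕ) : ℤ) ≤ 1000 := by push_cast; rw [hNr]; linarith
    exact_mod_cast this
  · rw [hNr, abs_le]
    rcases hσ with rfl | rfl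
    · simp only [one_mul] at x1 x2 ⊢
      constructor <;> nlinarith
    · simp only [neg_mul, one_mul, sub_neg_eq_add] at x1 x2 ⊢
      constructor <;> nlinarith

end Origin

end KS

end NegB

end PlanarSkeletonNeg

end Summit.CriticalPhenomena.PercolationContinuityZ3.Theorems.Transplant
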